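import Literature.AlgebraicGeometry.HodgeTheory.SemiregularityMap
import Summits.HodgeConjecture.HodgeConjecture.Theorems.SemiregularSeedsOnAnchors.Negative.SemiregularityCarrier

/-!
# C4 — the Koszul bridge `(K-B♮)`: Bloch's `τ_B` of a zero locus `Z(s)` versus the BF algebra of `E`;
# v1.2 (g21): the determinantal ∕ sheaf form `(K-B♮-det)`, `(K-B♮-𝓜)` — `E ↦ 𝓜`, `Z(s) ↦ V(Fitt_{p-1} 𝓜)`
(hsemireg-c4-1 g20 v1.1; g21 v1.2 = §6–§7 added, §1–§5 byte-unchanged)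

line stmt-HodgeConjecture-18881 Cruxes/BlochSeedDiscOne/Lines/birth.lean 814a6a70c14e831a stub_rung_pad4_seedAt

HONEST. Nothing in this file is proved toward HC / HC_CM / HC_AV / №4 / 26512 / 18881 / H2; it is a typed
consequence sheet, not a rung. The target of record of the LINE is the stub `stub_rung_pad4_seedAt`, whose
door is `HasBlochSeedAt 4 …`, which contains the REAL predicate `IsBlochSemiregular i (2·4) 4`
(`BlochSemiregularityMapReal.lean`). This file works one layer up, over the tree's hypothesis carriers
`AtiyahTraceAlgebra` (BF's algebra of `E`) and `SubspaceAtiyahTraceAlgebra` (BF's algebra of `𝒪_Z` with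
`T² = H¹(Z, 𝒩)` and Bloch's `τ_q = σ_q ∘ ε²`, `IsBlochSemiregular q`); the identification of the abstract
`IsBlochSemiregular 3` with the real `IsBlochSemiregular i 8 4` is BF Prop. 8.2, cite-only in the tree.
Designs ≠ displays ≠ sheaves ≠ SEED.

WHAT IS PACKAGED. The pen theorem of the memo `Cruxes/BlochSeedDiscOne/C4-KB-c4-1-g20.md` (§1–§4):

**THEOREM K-B♮ (pen; c4-1 g20).** `X` smooth projective over `ℂ`, `E` locally free of rank `p`, `s ∈ H⁰(E)`
Koszul-regular, `Z = Z(s)` (lci of codimension `p`, `𝒩_{Z/X} = E|_Z`, `𝒪_Z ≃ Kosz(E,s)`). Let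
`T² = T²_{(E,s)} = ℍ¹(X, [End E —ev_s→ E])` be the obstruction space of the pair, `π : T² → Ext²(E,E)` and
`β : T² → H¹(Z, 𝒩)` the two edge maps (`β = ℍ¹` of `σ_{≥-1}(Kosz ⊗ E) ↪ Kosz ⊗ E ≃ E|_Z`). Then, up to one
universal sign,
`τ_B ∘ β = δc_p(E) ∘ π`, `δc_p(E)(x) := Σ_{m=0}^{p-1} c_{p-1-m}(E) ∪ Tr(x · At(E)^m) = Σ_m P_m(E) ∪ σ^E_m(x)`,
`P_m = ∂c_p/∂ch_{m+1} = (-1)^m m! · c_{p-1-m}(E)` — "Bloch's semiregularity map of the zero locus is the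
derivative of the top Chern class `c_p(E) = [Z(s)]` along `Ext²(E,E)`". For `p = 4`: `(P₀,…,P₃) = (c₃, -c₂, 2c₁, -6)`.
Proof (memo §2–§4): Pridham's character `Ξ_p` (D¹ of `Ξ_p` at `𝒪_Z` = `τ_B` via BF Prop. 8.2; at a bundle = BF's
`σ_{p-1}`), the derived zero locus `Z^h(s) = X ×_{[𝔸^p/GL_p]} BGL_p` (its tangent map is `β` — LEMMA I1),
Waldhausen additivity along the stupid filtration of the Koszul complex (`Ξ_p(Kosz) ≃ Σ_j (-1)^j Ξ_p(Λ^j E^∨)`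
naturally — LEMMA I2), the Schur-derivation lemma (g19 Q-K §1) and a splitting-principle interpolation fixing
the coefficients (LEMMA P). Foundations imported as published, not re-derived: (F1) mapping-stack tangent
complexes and base change of normal bundles (Toën–Vezzosi), (F2) Waldhausen additivity and additivity of
`ch⁻`, (F3) Pridham Prop. 2.12 / Rem. 2.13 / Rem. 2.25 / p. 10 and BF Prop. 8.2.

For `E(t) = E ⊗ 𝒪(tΘ)`, `t ≫ 0`, `π` and `β` are isomorphisms (Serre vanishing), so `b_t = β ∘ π⁻¹` is the
g0 Koszul bridge and `τ_B = δc_4(E(t)) ∘ b_t⁻¹` with the explicit cubic pencil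
`δc_4(E(t)) = Σ_{k=1}^{4} (tθ)^{4-k} δc_k(E)` (memo §5, COROLLARY T).

v1.2 (g21, memo `Cruxes/BlochSeedDiscOne/C4-RCKB-c4-1-g21.md`). **THEOREM K-B♮-det (pen; c4-1 g21).** `φ : F → K` a map of
bundles of ranks `e ≤ f`, `p := f - e + 1`, `Z := D_{e-1}(φ)` of codimension `p` with `D_{e-2}(φ) = ∅` (corank one; `Z` lci,
`𝒩_{Z/X} = Hom(𝓛, 𝓠)`, `𝓛 = ker φ|_Z`, `𝓠 = coker φ|_Z`); `T² = ℍ¹(X, [End F ⊕ End K → Hom(F,K)])` the obstruction space of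
the triple, `π_F, π_K` its projections, `β = ℍ¹` of `c ↦ pr_𝓠 ∘ c|_Z ∘ ι_𝓛`. Then `τ_B ∘ β = ε · δc_p(K - F) ∘ (π_K, π_F)`,
`δc_p(K - F)(y_K, y_F) = Σ_{m < p} c_{p-1-m}(K - F) ∪ (Tr(y_K·At(K)^m) - Tr(y_F·At(F)^m))` — Bloch's map of a corank-one
degeneracy locus is the derivative of its Thom–Porteous class `[Z] = c_p(K - F)`; `e = 1` is K-B♮ (plus the `Pic` term).
**THEOREM K-B♮-𝓜.** For a coherent `𝓜` of homological dimension `≤ 1`, generic rank `p - 1`, `Fitt_p(𝓜) = 𝒪_X` and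
`Z = V(Fitt_{p-1} 𝓜)` of codimension `p`: `τ_B ∘ e₂ = ε · δc_p(𝓜)` on ALL of `Ext²(𝓜,𝓜)`, `e₂ : Ext²(𝓜,𝓜) → H¹(𝓔xt¹(𝓜,𝓜)) =
H¹(Z, 𝒩)` the local-to-global edge (K-B♮-det for the Serre presentation `𝒪(-m)^{⊕N} ↠ 𝓜`, whose `π_𝓜` is onto, plus trace
additivity). On the R-C road of hsemireg-monad-4 (THEOREM RC-E♯ + THEOREM RC-KB, B3FLAT-EXTISO-monad4-g21.md §2, §4 — of which
the g21 memo is the ×2 hand) this gives the closed-form door: `Z(s)` Bloch-semiregular ⟺ `δc₄(𝓔(tH))` injective on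
`Ext²(𝓔,𝓔)`, for the torsion-free design sheaf `𝓔 = ker q ∕ im i`. DICTIONARY for this file: the structure `KoszulBridgeDatum`
of §2 is presentation-agnostic — read `A` := BF algebra of the perfect complex `𝓜` (resp. `𝓔`), `T` := `T²` of a presenting
triple (resp. `Ext²(𝓜,𝓔)`), `proj` := `π_𝓜` (resp. `(∘f)`), `bridge` := `e₂ ∘ π_𝓜` (resp. `e₂ ∘ (f∘)`), `coeff m` :=
`∪ (-1)^m m!·c_{q-m}` of `[𝓜]` (resp. of `𝓔(tH)`), `kb` := K-B♮-𝓜 (resp. RC-KB); §3's `isBlochSemiregular_iff` is then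
monad-4's COROLLARY B3♭-T♯ verbatim, and §6 adds the two door read-outs proper to the sheaf form.

TYPED HERE (all sorry-free, no instance / notation / axiom):
* §1 `chernDerivative A q P = Σ_{m ≤ q} P_m ∘ σ_m` and its vanishing on `⋂_m ker σ_m` (sandwich classes, g19 LEMMA K);
* §2 `KoszulBridgeDatum A B q T`: the data `(π, β, toCoh, P_m)` with the identity `(K-B♮)` as the field `kb`
  (a PREDICATE-CARRIER: nothing asserts that a given `(E, s)` furnishes one — that is THEOREM K-B♮, pen);
* §3 consequences: a sandwich class with `β ≠ 0` kills `IsBlochSemiregular q` (any `t`); in the bridge regime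
  (`π` onto, `β` into — `t ≫ 0`) Bloch-semiregularity of `Z(s)` ⇒ `E` is `I`-semiregular for `I = {0,…,q}`,
  ⇒ `δc` injective ⇒ `ext²(E,E) ≤ h^{q,q+2}` (`≤ 3136` on an abelian 8-fold, `q = 3`); with `π`, `β` bijective
  `IsBlochSemiregular q ↔ Injective (δc)` — the cycle door of the LINE, at `t ≫ 0`, is decided on `Ext²(E,E)`;
* §4 the link with g19's sandwich classes (`C4BFSandwich.SandwichDatum`, LEMMA K: `b∘ψ = 0 ⇒ (ψ⊗1)∘b ∈ ⋂_m ker σ_m`):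
  such a class hit by `π` from `x` with `β(x) ≠ 0` ⇒ `¬ IsBlochSemiregular q`; conversely Bloch-semiregularity at `t ≫ 0`
  owes the sandwich-vanishing `(S-V)` of g19;
* §5 numbers: the coefficient signs `(1, -1, 2, -6)`, the calibration dimensions of the complete-intersection
  examples of the memo (§6: `Z = D ∩ D′`, `D ∼ D′` very ample on an abelian 8-fold is NOT Bloch-semiregular,
  `dim ker τ_B = 3·h^{0,2} = 84` of `112`, rank `28`; four equal divisors: `dim ker ≥ 15·28 = 420` of `448`);
* §6 (v1.2) the sheaf-form door: a pencil-kernel class with `β ≠ 0` kills `IsBlochSemiregular q`; with `β` onto,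
  `IsBlochSemiregular q ↔ (δ(π x) = 0 → β x = 0)`; with `π` onto and `β = e ∘ π`, `e` onto (the K-B♮-𝓜 regime: `e = e₂`,
  `ker e₂ = H^{0,2}·id_𝓜` on the R-C road), `IsBlochSemiregular q ↔ ker δ ≤ ker e`;
* §7 (v1.2) numbers for K-B♮-det: Eagon–Northcott ranks `rk EN_j = C(f, e-1+j)·C(e+j-2, j-1)` and their vanishing Euler
  characteristic at the display ranks `(e,f) = (a+1, a+4)`, `a = 1…4`; the expected codimension `(f-(e-1))·(e-(e-1)) = p` of the
  corank-one stratum; the third Newton identity behind the scalar consistency `δc₄([𝓜])(id) = (rk 𝓜 - 3)·c₃ = 0`.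

References: [cite: BuchweitzFlenner2003, Def. 4.1, §5, (8.1), Prop. 8.2]
[cite: Eisenbud1995, App. A2.6, Thm. A2.10 (Eagon–Northcott complex; exactness in the expected grade)]
[cite: Fulton1998, Thm. 14.4 and Ex. 14.4.7 (Thom–Porteous), Ex. 18.3.11]
[cite: Pridham2024Semiregularity, Def. 1.1–1.3, Lemma 1.7, Lemma 1.11, Prop. 2.12, Rem. 2.13, Rem. 2.25, p. 10 (arXiv:1208.3111 numbering)]
[cite: IaconoManetti2013SemiregularityCI, Introduction (set-up Z = Z(f)) and Thm. 11.1]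
[cite: GreenMurreVoisin1994, Voisin Lecture 2, Thm. 2.3 (p. 154: Bloch's variational formula)]
[cite: Bloch1972Semiregularity, §4–§6 (cite-only)]
-/

universe u v w

noncomputable section

namespace HSemireg.C4KoszulBridge

open Literature.AlgebraicGeometry.HodgeTheory

/-! ### §1 The Chern-derivative operator `δ_P = Σ_{m ≤ q} P_m ∘ σ_m` -/

section ChernDerivative

variable {𝕜 : Type u} [CommRing 𝕜] (A : AtiyahTraceAlgebra.{u, v} 𝕜) (q : ℕ)

/-- **The Chern-derivative operator** `δ_P : Ext²(E,E) → H^{q+2}(X, Ω^q)`, `δ_P(x) = Σ_{m=0}^{q} P_m(σ_m(x))`, for a family of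
coefficient maps `P_m : H^{m+2}(X, Ω^m) → H^{q+2}(X, Ω^q)` (geometrically `P_m = ∪ (∂c_{q+1}/∂ch_{m+1})(E) = ∪ (-1)^m m!·c_{q-m}(E)`,
THEOREM K-B♮ / LEMMA P of the memo; here abstract `𝕜`-linear maps). With those `P_m` this is `δc_{q+1}(E)`, the derivative of
the top Chern class along `Ext²(E,E)`. [cite: BuchweitzFlenner2003, Def. 4.1] -/
def chernDerivative (P : (m : ℕ) → A.Coh (m + 2) m →ₗ[𝕜] A.Coh (q + 2) q) : A.Ext 2 0 →ₗ[𝕜] A.Coh (q + 2) q :=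
  ∑ m ∈ Finset.range (q + 1), P m ∘ₗ A.semiregularityComponent m

/-- Unfolding `δ_P(x) = Σ_{m ≤ q} P_m(σ_m(x))`. [cite: BuchweitzFlenner2003, Def. 4.1] -/
theorem chernDerivative_apply (P : (m : ℕ) → A.Coh (m + 2) m →ₗ[𝕜] A.Coh (q + 2) q) (x : A.Ext 2 0) :
    chernDerivative A q P x = ∑ m ∈ Finset.range (q + 1), P m (A.semiregularityComponent m x) := by
  rw [chernDerivative, LinearMap.sum_apply]
  rfl

/-- **`δ_P` kills the common kernel of `σ_0, …, σ_q`** — in particular every sandwich class (g19 LEMMA K: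
`σ_m((ψ⊗1)∘b) = 0` for all `m` when `b∘ψ = 0`). [cite: BuchweitzFlenner2003, Def. 4.1] -/
theorem chernDerivative_eq_zero_of_sigma_eq_zero (P : (m : ℕ) → A.Coh (m + 2) m →ₗ[𝕜] A.Coh (q + 2) q)
    {x : A.Ext 2 0} (hx : ∀ m ≤ q, A.semiregularityComponent m x = 0) : chernDerivative A q P x = 0 := by
  rw [chernDerivative_apply]
  refine Finset.sum_eq_zero fun m hm => ?_
  rw [hx m (Nat.lt_succ_iff.mp (Finset.mem_range.mp hm)), map_zero]

/-- `δ_P` kills `ker σ` (the whole BF semiregularity map). [cite: BuchweitzFlenner2003, Def. 4.1] -/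
theorem chernDerivative_eq_zero_of_semiregularityMap_eq_zero (P : (m : ℕ) → A.Coh (m + 2) m →ₗ[𝕜] A.Coh (q + 2) q)
    {x : A.Ext 2 0} (hx : A.semiregularityMap x = 0) : chernDerivative A q P x = 0 :=
  chernDerivative_eq_zero_of_sigma_eq_zero A q P fun m _ => by
    rw [← AtiyahTraceAlgebra.semiregularityMap_apply, hx]
    rfl

/-- If `δ_P` is injective then `E` is `I`-semiregular for `I = {0, …, q}` (BF §5). [cite: BuchweitzFlenner2003, §5 (I-semiregular)] -/
theorem isISemiregular_of_injective_chernDerivative (P : (m : ℕ) → A.Coh (m + 2) m →ₗ[𝕜] A.Coh (q + 2) q)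
    (h : Function.Injective (chernDerivative A q P)) : A.IsISemiregular (Set.Iic q) :=
  fun x hx => h (by rw [map_zero]; exact chernDerivative_eq_zero_of_sigma_eq_zero A q P fun m hm => hx m (Set.mem_Iic.mpr hm))

end ChernDerivative

/-! ### §2 The Koszul bridge datum: `τ_B ∘ β = δ_P ∘ π` -/

/-- **Koszul bridge datum** for a pair `(E, s)` with zero locus `Z = Z(s)` of codimension `q + 1` (hypothesis structure).
`A` = BF carrier of `E`; `B` = BF subspace carrier of `Z ⊆ X` (`B.T2 = H¹(Z, 𝒩_{Z/X})`, `B.blochSemiregularityMap q = τ_B`);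
`T = T²_{(E,s)} = ℍ¹(X, [End E —ev_s→ E])` the obstruction space of the pair; `proj = π : T² → Ext²(E,E)` and
`bridge = β : T² → H¹(Z, 𝒩)` the edge maps; `toCoh` the identification of `H^{q+2}(X, Ω^q)` in the two carriers
(geometrically the identity, hence injective); `coeff m = P_m = ∪ (-1)^m m!·c_{q-m}(E)`. The field `kb` is the conclusion of
THEOREM K-B♮: `τ_B ∘ β = δc_{q+1}(E) ∘ π`. A PREDICATE-CARRIER: that a given `(E, s)` on a smooth projective `X/ℂ` furnishes
one is the pen theorem (memo §1–§4, foundations (F1)–(F3)), NOT asserted here.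
[cite: BuchweitzFlenner2003, Def. 4.1, Def. 4.10, Prop. 8.2] [cite: Pridham2024Semiregularity, Prop. 2.12, Rem. 2.13, Rem. 2.25] -/
structure KoszulBridgeDatum {𝕜 : Type u} [CommRing 𝕜] (A : AtiyahTraceAlgebra.{u, v} 𝕜)
    (B : SubspaceAtiyahTraceAlgebra.{u, v} 𝕜) (q : ℕ) (T : Type w) [AddCommGroup T] [Module 𝕜 T] where
  /-- `π : T²_{(E,s)} → Ext²(E,E)` (forget the section). [cite: BuchweitzFlenner2003, §4] -/
  proj : T →ₗ[𝕜] A.Ext 2 0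
  /-- `β : T²_{(E,s)} → H¹(Z, 𝒩_{Z/X})`, `ℍ¹` of `σ_{≥-1}(Kosz(E,s) ⊗ E) ↪ Kosz(E,s) ⊗ E ≃ E|_Z = 𝒩` (the tangent map of
  `(E,s) ↦ Z(s)`, LEMMA I1). [cite: Pridham2024Semiregularity, Lemma 1.7 and Rem. 2.25] -/
  bridge : T →ₗ[𝕜] B.T2
  /-- `H^{q+2}(X, Ω^q)` of the `𝒪_Z`-carrier → `H^{q+2}(X, Ω^q)` of the `E`-carrier (geometrically the identity).
  [cite: BuchweitzFlenner2003, §4] -/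
  toCoh : B.Coh (q + 2) q →ₗ[𝕜] A.Coh (q + 2) q
  /-- … which is injective. [cite: BuchweitzFlenner2003, §4] -/
  injective_toCoh : Function.Injective toCoh
  /-- `P_m = ∪ (∂c_{q+1}/∂ch_{m+1})(E) = ∪ (-1)^m m!·c_{q-m}(E) : H^{m+2}(Ω^m) → H^{q+2}(Ω^q)` (LEMMA P).
  [cite: BuchweitzFlenner2003, Def. 4.1] -/
  coeff : (m : ℕ) → A.Coh (m + 2) m →ₗ[𝕜] A.Coh (q + 2) q
  /-- **(K-B♮)** `τ_B ∘ β = δc_{q+1}(E) ∘ π` on `T²_{(E,s)}` (THEOREM K-B♮, pen).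
  [cite: Pridham2024Semiregularity, Prop. 2.12, Rem. 2.13, Rem. 2.25, p. 10] [cite: BuchweitzFlenner2003, Prop. 8.2] -/
  kb : toCoh ∘ₗ B.blochSemiregularityMap q ∘ₗ bridge = chernDerivative A q coeff ∘ₗ proj

namespace KoszulBridgeDatum

variable {𝕜 : Type u} [CommRing 𝕜] {A : AtiyahTraceAlgebra.{u, v} 𝕜} {B : SubspaceAtiyahTraceAlgebra.{u, v} 𝕜}
  {q : ℕ} {T : Type w} [AddCommGroup T] [Module 𝕜 T] (D : KoszulBridgeDatum A B q T)

/-- `(K-B♮)` pointwise: `τ_B(β x) = δ_P(π x)` (read in the `E`-carrier). [cite: BuchweitzFlenner2003, Prop. 8.2] -/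
theorem kb_apply (x : T) :
    D.toCoh (B.blochSemiregularityMap q (D.bridge x)) = chernDerivative A q D.coeff (D.proj x) := by
  have h := LinearMap.congr_fun D.kb x
  simpa only [LinearMap.coe_comp, Function.comp_apply] using h

/-! ### §3 Consequences: the cycle door of `Z(s)` read on `Ext²(E,E)` -/

/-- **A sandwich direction is killed by `τ_B`.** If `π(x)` lies in `⋂_{m ≤ q} ker σ_m` (e.g. `π(x)` a sandwich class) then
`τ_B(β(x)) = 0` — for EVERY pair `(E,s)`, no `t ≫ 0` needed. [cite: BuchweitzFlenner2003, Def. 4.1 and Prop. 8.2] -/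
theorem bloch_bridge_eq_zero {x : T} (hx : ∀ m ≤ q, A.semiregularityComponent m (D.proj x) = 0) :
    B.blochSemiregularityMap q (D.bridge x) = 0 :=
  D.injective_toCoh (by rw [map_zero, D.kb_apply, chernDerivative_eq_zero_of_sigma_eq_zero A q D.coeff hx])

/-- **Would-be kill of the cycle door.** One `x ∈ T²_{(E,s)}` with `σ_m(π x) = 0` for all `m ≤ q` and `β(x) ≠ 0` refutes
Bloch-semiregularity of `Z(s)` in degree `q` (memo §5 (C2); at `t = 0` one needs `β(x) ≠ 0`, which holds e.g. when
`H^j(Λ^j E^∨ ⊗ E) = 0` for `2 ≤ j ≤ q+1`). [cite: BuchweitzFlenner2003, §1 and Prop. 8.2] -/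
theorem not_isBlochSemiregular_of_sandwich {x : T} (hx : ∀ m ≤ q, A.semiregularityComponent m (D.proj x) = 0)
    (hne : D.bridge x ≠ 0) : ¬ B.IsBlochSemiregular q :=
  fun h => hne (h (by rw [D.bloch_bridge_eq_zero hx, map_zero]))

/-- In the bridge regime "`β` injective" (`t ≫ 0`: `H^j(Λ^j E^∨ ⊗ E((1-j)t)) = 0`, `j ≥ 2`), Bloch-semiregularity of `Z(s)` forces
every `x ∈ T²` with `π(x) ∈ ⋂_{m ≤ q} ker σ_m` to vanish. [cite: BuchweitzFlenner2003, §5 and Prop. 8.2] -/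
theorem eq_zero_of_isBlochSemiregular (h : B.IsBlochSemiregular q) (hβ : Function.Injective D.bridge) {x : T}
    (hx : ∀ m ≤ q, A.semiregularityComponent m (D.proj x) = 0) : x = 0 :=
  hβ (by rw [map_zero]; exact h (by rw [D.bloch_bridge_eq_zero hx, map_zero]))

/-- **(C1) Bloch-semiregular zero locus ⇒ `I`-semiregular bundle.** In the bridge regime (`π` onto: `H²(E) = 0`; `β` into),
`IsBlochSemiregular q` for `Z(s)` implies that `E` is `I`-semiregular for `I = {0, …, q}` (BF §5): every class in
`⋂_{m ≤ q} ker σ^E_m` — in particular every sandwich class `(ψ⊗1)∘b`, `b∘ψ = 0` — is ZERO. This is the obligation `(S-V)`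
of g19, now owed by the LINE's own door. [cite: BuchweitzFlenner2003, §5 (I-semiregular) and Prop. 8.2] -/
theorem isISemiregular_of_isBlochSemiregular (h : B.IsBlochSemiregular q) (hπ : Function.Surjective D.proj)
    (hβ : Function.Injective D.bridge) : A.IsISemiregular (Set.Iic q) := by
  intro y hy
  obtain ⟨x, rfl⟩ := hπ y
  rw [D.eq_zero_of_isBlochSemiregular h hβ fun m hm => hy m (Set.mem_Iic.mpr hm), map_zero]

/-- … hence `E` is BF-semiregular. [cite: BuchweitzFlenner2003, §5 and §7] -/
theorem isSemiregular_of_isBlochSemiregular (h : B.IsBlochSemiregular q) (hπ : Function.Surjective D.proj)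
    (hβ : Function.Injective D.bridge) : A.IsSemiregular :=
  (D.isISemiregular_of_isBlochSemiregular h hπ hβ).isSemiregular

/-- **Bloch-semiregular zero locus ⇒ `δc_{q+1}(E)` injective on `Ext²(E,E)`** (bridge regime). Sharper than (C1): the single
map `δ_P = Σ P_m ∘ σ_m` to the single target `H^{q+2}(X, Ω^q)` is injective. [cite: BuchweitzFlenner2003, Prop. 8.2] -/
theorem injective_chernDerivative_of_isBlochSemiregular (h : B.IsBlochSemiregular q) (hπ : Function.Surjective D.proj)
    (hβ : Function.Injective D.bridge) : Function.Injective (chernDerivative A q D.coeff) := by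
  rw [injective_iff_map_eq_zero]
  intro y hy
  obtain ⟨x, rfl⟩ := hπ y
  have h1 : B.blochSemiregularityMap q (D.bridge x) = 0 := D.injective_toCoh (by rw [map_zero, D.kb_apply, hy])
  have h2 : D.bridge x = 0 := h (by rw [h1, map_zero])
  have h3 : x = 0 := hβ (by rw [h2, map_zero])
  rw [h3, map_zero]

/-- **Positive transfer.** If `δc_{q+1}(E)` is injective on `Ext²(E,E)`, `π` is injective (`H¹(E) = 0`) and `β` is onto
(`H^{j+1}(Λ^j E^∨ ⊗ E) = 0`, `2 ≤ j ≤ q+1`), then `Z(s)` IS Bloch-semiregular in degree `q`. E.g. `Ext²(E,E) = H²(𝒪_X)·id_E`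
(simple semi-homogeneous `E`): `δc_4(ω·id) = ω ∪ c₃(E(t))`, injective for `t ≫ 0` by hard Lefschetz (memo §6).
[cite: BuchweitzFlenner2003, §1 and Prop. 8.2] -/
theorem isBlochSemiregular_of_injective_chernDerivative (hδ : Function.Injective (chernDerivative A q D.coeff))
    (hπ : Function.Injective D.proj) (hβ : Function.Surjective D.bridge) : B.IsBlochSemiregular q := by
  show Function.Injective (B.blochSemiregularityMap q)
  rw [injective_iff_map_eq_zero]
  intro t ht
  obtain ⟨x, rfl⟩ := hβ t
  have h1 : chernDerivative A q D.coeff (D.proj x) = 0 := by rw [← D.kb_apply, ht, map_zero]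
  have h2 : D.proj x = 0 := hδ (by rw [h1, map_zero])
  have h3 : x = 0 := hπ (by rw [h2, map_zero])
  rw [h3, map_zero]

/-- **THE DOOR ON `Ext²(E,E)`.** With `π` and `β` bijective (`t ≫ 0`: `H¹(E) = H²(E) = 0` and
`H^j = H^{j+1} = 0` of `Λ^j E^∨ ⊗ E((1-j)t)`, `2 ≤ j ≤ q+1`): `Z(s)` is Bloch-semiregular in degree `q` IFF `δc_{q+1}(E(t))` is
injective on `Ext²(E,E)` — the cycle door of the LINE at `t ≫ 0` is decided by the BF algebra of `E` and the Chern classes.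
[cite: BuchweitzFlenner2003, Prop. 8.2] [cite: Pridham2024Semiregularity, Prop. 2.12 and Rem. 2.25] -/
theorem isBlochSemiregular_iff (hπ : Function.Bijective D.proj) (hβ : Function.Bijective D.bridge) :
    B.IsBlochSemiregular q ↔ Function.Injective (chernDerivative A q D.coeff) :=
  ⟨fun h => D.injective_chernDerivative_of_isBlochSemiregular h hπ.2 hβ.1,
    fun h => D.isBlochSemiregular_of_injective_chernDerivative h hπ.1 hβ.2⟩

end KoszulBridgeDatum

/-! ### §3b Dimension consequences over a field -/

section Field

variable {K : Type u} [Field K] {A : AtiyahTraceAlgebra.{u, v} K} {B : SubspaceAtiyahTraceAlgebra.{u, v} K}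
  {q : ℕ} {T : Type w} [AddCommGroup T] [Module K T]

/-- **Forced kernel through the bridge.** In the bridge regime a Bloch-semiregular `Z(s)` needs
`ext²(E,E) ≤ h^{q,q+2}(X) = dim H^{q+2}(X, Ω^q)` (one target only — sharper than the BF sum `Σ_m h^{m,m+2}`). [folklore]
[cite: BuchweitzFlenner2003, §5 and Prop. 8.2] -/
theorem finrank_ext_le_of_isBlochSemiregular (D : KoszulBridgeDatum A B q T) [FiniteDimensional K (A.Coh (q + 2) q)]
    (h : B.IsBlochSemiregular q) (hπ : Function.Surjective D.proj) (hβ : Function.Injective D.bridge) :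
    Module.finrank K (A.Ext 2 0) ≤ Module.finrank K (A.Coh (q + 2) q) :=
  LinearMap.finrank_le_finrank_of_injective (D.injective_chernDerivative_of_isBlochSemiregular h hπ hβ)

/-- **Codimension 4 on an abelian 8-fold** (`q = 3`, `h^{3,5} = C(8,5)·C(8,3) = 3136`, g19 `h35_abelian_eightfold`): in the
bridge regime, `IsBlochSemiregular 3` for `Z(s)` needs `ext²(E,E) ≤ 3136`. [folklore] [cite: BuchweitzFlenner2003, §5] -/
theorem finrank_ext_le_3136 (D : KoszulBridgeDatum A B 3 T) [FiniteDimensional K (A.Coh 5 3)]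
    (hdim : Module.finrank K (A.Coh 5 3) = 3136) (h : B.IsBlochSemiregular 3) (hπ : Function.Surjective D.proj)
    (hβ : Function.Injective D.bridge) : Module.finrank K (A.Ext 2 0) ≤ 3136 := by
  rw [← hdim]
  exact finrank_ext_le_of_isBlochSemiregular D h hπ hβ

/-- Contrapositive: `ext²(E,E) > h^{q,q+2}` in the bridge regime ⇒ `Z(s)` is NOT Bloch-semiregular in degree `q`. [folklore] -/
theorem not_isBlochSemiregular_of_lt_finrank (D : KoszulBridgeDatum A B q T) [FiniteDimensional K (A.Coh (q + 2) q)]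
    [FiniteDimensional K (A.Ext 2 0)] (hlt : Module.finrank K (A.Coh (q + 2) q) < Module.finrank K (A.Ext 2 0))
    (hπ : Function.Surjective D.proj) (hβ : Function.Injective D.bridge) : ¬ B.IsBlochSemiregular q :=
  fun h => (Nat.lt_irrefl _) (lt_of_le_of_lt (finrank_ext_le_of_isBlochSemiregular D h hπ hβ) hlt)

end Field

/-! ### §4 Link with the g19 sandwich classes (`C4BFSandwich.SandwichDatum`, LEMMA K)

The g19 file `Cruxes/BlochSeedDiscOne/C4BFSandwich.lean` (tree, commit e01670648cc1) proves
`SandwichDatum.semiregularityComponent_post_eq_zero : S.pre 2 0 ψ b = 0 → ∀ m, σ_m (S.post 2 0 ψ b) = 0`, i.e. a sandwich class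
`y = (ψ⊗1)∘b` with `b∘ψ = 0` lies in `⋂_m ker σ_m`. The two theorems below take exactly that conclusion as the hypothesis `hy`
(so they apply verbatim to `y = S.post 2 0 ψ b`; the import is not repeated here to keep this file independent of the build
order of the Cruxes directory). -/

section Sandwich

variable {𝕜 : Type u} [CommRing 𝕜] {A : AtiyahTraceAlgebra.{u, v} 𝕜} {B : SubspaceAtiyahTraceAlgebra.{u, v} 𝕜}
  {q : ℕ} {T : Type w} [AddCommGroup T] [Module 𝕜 T] (D : KoszulBridgeDatum A B q T)

/-- **Monad sandwich vs the cycle door, negative side.** A class `y ∈ ⋂_m ker σ^E_m` (a sandwich class `(ψ⊗1)∘b`, `b∘ψ = 0`,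
g19 LEMMA K — e.g. from an admissible pair `(Z, Z′)` of a display), hit by `π` from an `x ∈ T²_{(E,s)}` with `β(x) ≠ 0`,
refutes `IsBlochSemiregular q` for `Z(s)`. [cite: BuchweitzFlenner2003, Def. 4.1 and Prop. 8.2] -/
theorem not_isBlochSemiregular_of_sandwichClass {y : A.Ext 2 0} (hy : ∀ m, A.semiregularityComponent m y = 0) {x : T}
    (hx : D.proj x = y) (hne : D.bridge x ≠ 0) : ¬ B.IsBlochSemiregular q :=
  D.not_isBlochSemiregular_of_sandwich (fun m _ => by rw [hx]; exact hy m) hne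

/-- **Monad sandwich vs the cycle door, obligation side `(S-V)`.** In the bridge regime (`t ≫ 0`), if `Z(s)` is
Bloch-semiregular then every class in `⋂_m ker σ^E_m` — every sandwich class of `E` — is ZERO. For the program-M tables of
g19 (216∕240 hot admissible pairs per table) each hot pair is therefore an obstruction-unless-`(S-V)` for the LINE's own door.
[cite: BuchweitzFlenner2003, §5 and Prop. 8.2] -/
theorem sandwichClass_eq_zero_of_isBlochSemiregular (h : B.IsBlochSemiregular q) (hπ : Function.Surjective D.proj)
    (hβ : Function.Injective D.bridge) {y : A.Ext 2 0} (hy : ∀ m, A.semiregularityComponent m y = 0) : y = 0 :=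
  (AtiyahTraceAlgebra.isSemiregular_iff A).1 (D.isSemiregular_of_isBlochSemiregular h hπ hβ) y hy

end Sandwich

/-! ### §5 Numbers: coefficient signs and the complete-intersection calibration (memo §4, §6) -/

section Numbers

/-- **LEMMA P, normalisation.** `P_m = (-1)^m m! · c_{p-1-m}(E)`; the scalar factors for `m = 0,…,3` are `(1, -1, 2, -6)`, i.e.
`(P₀, P₁, P₂, P₃) = (c₃, -c₂, 2c₁, -6)` for `p = 4`. [cite: BuchweitzFlenner2003, Def. 4.1] -/
theorem coeffSigns : ((List.range 4).map fun m => (-1 : ℤ) ^ m * (Nat.factorial m : ℤ)) = [1, -1, 2, -6] := by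
  decide

/-- The Newton–Girard step behind `∂c₄/∂ch₄ = -6`: `24 · e₄ = p₁⁴ - 6p₁²p₂ + 3p₂² + 8p₁p₃ - 6p₄`, so `∂e₄/∂p₄ = -6/24 = -1/4`
and `P₃ = 3!·4·(-1/4) = -6`; integer shadow `6 · 4 = 24 = 4!`. [folklore] -/
theorem newton_e4_shadow : 6 * 4 = Nat.factorial 4 ∧ Nat.factorial 3 = 6 := by
  decide

/-- **Calibration CI-2 (memo §6(b)).** `Z = D ∩ D′`, `D ∼ D′` very ample on an abelian 8-fold, `E = 𝒪(D)^{⊕2}`: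
`Ext²(E,E) = H²(𝒪)^{⊕4}` has dimension `4·28 = 112`; `δc₂(x) = (x₁₁ + x₂₂) ∪ [D]` kills the two off-diagonal blocks
(sandwiches, `2·28 = 56`) and the antidiagonal (`28`): `dim ker τ_B = 84`, `rank τ_B = 112 - 84 = 28`; independently, both
components of Bloch's map land in `H^{0,2} ∪ [D]` (dual map through `H⁵(D, 𝒪_D(D)) ≅ H⁶(𝒪_X)`, of dimension `C(8,6) = 28`),
so classically `rank τ_B ≤ 28 ≤ h^{1,3} = 8·56` — the same digit both ways. [folklore] [cite: BuchweitzFlenner2003, (8.1) (2)] -/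
theorem calibration_ci2 :
    Nat.choose 8 2 = 28 ∧ 4 * 28 = 112 ∧ 2 * 28 + 28 = 84 ∧ 112 - 84 = 28 ∧ Nat.choose 8 6 = 28 ∧
      28 ≤ 8 * Nat.choose 8 3 := by
  decide

/-- **Calibration CI-4 (memo §6).** `Z = D₁ ∩ ⋯ ∩ D₄`, all `Dᵢ ∼ D` very ample on an abelian 8-fold, `E = 𝒪(D)^{⊕4}`:
`ext²(E,E) = 16·28 = 448`, `δc₄(x) = Tr(x) ∪ [D]³` kills the traceless part, `dim ker τ_B ≥ 15·28 = 420`, `rank τ_B ≤ 28`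
inside `H⁵(X, Ω³)` of dimension `3136`. [folklore] [cite: BuchweitzFlenner2003, (8.1) (2)] -/
theorem calibration_ci4 : 16 * 28 = 448 ∧ 15 * 28 = 420 ∧ 448 - 420 = 28 ∧ 28 ≤ Nat.choose 8 5 * Nat.choose 8 3 := by
  decide

end Numbers

/-! ### §6 (v1.2, g21) The sheaf-form door: read-outs proper to `(K-B♮-𝓜)` and to the R-C road

In the sheaf form the datum is `(A, T, proj, bridge) = (BF algebra of 𝓜, T² of a presenting triple, π_𝓜, e₂ ∘ π_𝓜)`: for the
Serre presentation `proj` is ONTO but not injective, and `bridge = e₂ ∘ proj` with `e₂` onto and `ker e₂ = H²(𝓗om(𝓜,𝓜))`-image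
(`= H^{0,2}·id_𝓜` on the R-C road, monad-4 THEOREM RC-E♯ (b)(d)). The door then reads `ker δc_p(𝓜) ≤ ker e₂`
(`isBlochSemiregular_iff_ker_le`); the scalar consistency `δc_p([𝓜])(id_𝓜) = (rk 𝓜 - (p-1))·c_{p-1} = 0` (§7
`newton_girard_third`) is what makes the two kernels comparable at all. -/

namespace KoszulBridgeDatum

variable {𝕜 : Type u} [CommRing 𝕜] {A : AtiyahTraceAlgebra.{u, v} 𝕜} {B : SubspaceAtiyahTraceAlgebra.{u, v} 𝕜}
  {q : ℕ} {T : Type w} [AddCommGroup T] [Module 𝕜 T] (D : KoszulBridgeDatum A B q T)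

/-- **Pencil-kernel kill (monad-4 COROLLARY B3♭-T♯ (i), general form).** One `x ∈ T` with `δ_P(π x) = 0` and `β(x) ≠ 0`
refutes `IsBlochSemiregular q` — no regime hypothesis. (§3's `not_isBlochSemiregular_of_sandwich` is the case `π x ∈ ⋂ ker σ_m`.)
[cite: BuchweitzFlenner2003, Prop. 8.2] [cite: Pridham2024Semiregularity, Prop. 2.12 and Rem. 2.25] -/
theorem not_isBlochSemiregular_of_chernDerivative_eq_zero {x : T}
    (hx : chernDerivative A q D.coeff (D.proj x) = 0) (hne : D.bridge x ≠ 0) : ¬ B.IsBlochSemiregular q :=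
  fun h => hne (h (by rw [map_zero]; exact D.injective_toCoh (by rw [map_zero, D.kb_apply, hx])))

/-- **The door with `β` onto** (`e₂` onto: monad-4 THEOREM RC-E♯ 2.5; Serre presentation: `π_𝓜` onto): `Z` is Bloch-semiregular
in degree `q` iff every `x ∈ T` in the kernel of the Chern derivative has `β(x) = 0`. [cite: BuchweitzFlenner2003, Prop. 8.2] -/
theorem isBlochSemiregular_iff_of_surjective_bridge (hβ : Function.Surjective D.bridge) :
    B.IsBlochSemiregular q ↔ ∀ x : T, chernDerivative A q D.coeff (D.proj x) = 0 → D.bridge x = 0 := by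
  constructor
  · intro h x hx
    exact h (by rw [map_zero]; exact D.injective_toCoh (by rw [map_zero, D.kb_apply, hx]))
  · intro h
    show Function.Injective (B.blochSemiregularityMap q)
    rw [injective_iff_map_eq_zero]
    intro t ht
    obtain ⟨x, rfl⟩ := hβ t
    exact h x (by rw [← D.kb_apply, ht, map_zero])

/-- **THE SHEAF-FORM DOOR `(K-B♮-𝓜)`.** If `π` is onto (Serre presentation) and `β = e ∘ π` for an onto `e : Ext²(𝓜,𝓜) → H¹(Z,𝒩)`
(the local-to-global edge `e₂`), then `Z = V(Fitt_{p-1} 𝓜)` is Bloch-semiregular in degree `q = p - 1` iff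
`ker δc_p(𝓜) ≤ ker e₂` — on the R-C road `ker e₂ = H^{0,2}·id_𝓜` (monad-4 THEOREM RC-E♯ (b)), so: iff the Chern derivative of
`[𝓜]` kills nothing but the scalars. [cite: BuchweitzFlenner2003, Prop. 8.2] [cite: Pridham2024Semiregularity, Prop. 2.12, Rem. 2.13, Rem. 2.25] -/
theorem isBlochSemiregular_iff_ker_le (e : A.Ext 2 0 →ₗ[𝕜] B.T2) (he : D.bridge = e ∘ₗ D.proj)
    (hπ : Function.Surjective D.proj) (hes : Function.Surjective e) :
    B.IsBlochSemiregular q ↔ LinearMap.ker (chernDerivative A q D.coeff) ≤ LinearMap.ker e := by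
  rw [D.isBlochSemiregular_iff_of_surjective_bridge (by rw [he]; exact hes.comp hπ)]
  constructor
  · intro h y hy
    obtain ⟨x, rfl⟩ := hπ y
    have hx : D.bridge x = 0 := h x (LinearMap.mem_ker.mp hy)
    rw [he] at hx
    exact LinearMap.mem_ker.mpr hx
  · intro h x hx
    have hx' : D.proj x ∈ LinearMap.ker e := h (LinearMap.mem_ker.mpr hx)
    rw [he]
    exact LinearMap.mem_ker.mp hx'

/-- **Positive read-out of the sheaf form.** If `ker δc_p(𝓜) ≤ ker e₂` — e.g. `Ext²(𝓔,𝓔) = H^{0,2}·id_𝓔` on the R-C road, where the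
pencil on scalars is `c ↦ c ∪ (4t³H³ + 3t²H²c₁ + 2tHc₂ + c₃)`, injective for `t ≫ 0` by hard Lefschetz (monad-4 B3♭-T♯ (ii)) — then `Z`
IS Bloch-semiregular. [cite: BuchweitzFlenner2003, Prop. 8.2] -/
theorem isBlochSemiregular_of_ker_le (e : A.Ext 2 0 →ₗ[𝕜] B.T2) (he : D.bridge = e ∘ₗ D.proj)
    (hπ : Function.Surjective D.proj) (hes : Function.Surjective e)
    (h : LinearMap.ker (chernDerivative A q D.coeff) ≤ LinearMap.ker e) : B.IsBlochSemiregular q :=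
  (D.isBlochSemiregular_iff_ker_le e he hπ hes).2 h

end KoszulBridgeDatum

/-! ### §7 (v1.2, g21) Numbers for `(K-B♮-det)`: Eagon–Northcott ranks, expected codimension, Newton -/

section NumbersDet

/-- Rank of the `j`-th Eagon–Northcott term for `φ : F → K`, `rk F = e ≤ rk K = f`:
`EN_0 = 𝒪`, `EN_j = Λ^{e-1+j} K^∨ ⊗ S^{j-1} F ⊗ det F` (`1 ≤ j ≤ f - e + 1`). [cite: Eisenbud1995, App. A2.6] -/
def enRank (e f j : ℕ) : ℕ :=
  if j = 0 then 1 else Nat.choose f (e - 1 + j) * Nat.choose (e + j - 2) (j - 1)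

/-- **E–N ranks at the display ranks `(e, f) = (a+1, a+4)`, `a = 1,…,4` (corank one, `p = 4`), and their vanishing Euler
characteristic** (memo §4, check (E); the K-class `Σ_j (-1)^j [EN_j]` has rank `0 = rk 𝒪_Z`):
`(1,10,20,15,4)`, `(1,20,45,36,10)`, `(1,35,84,70,20)`, `(1,56,140,120,35)`. [cite: Eisenbud1995, Thm. A2.10] -/
theorem enRank_display :
    (List.range 5).map (enRank 2 5) = [1, 10, 20, 15, 4] ∧ (List.range 5).map (enRank 3 6) = [1, 20, 45, 36, 10] ∧
      (List.range 5).map (enRank 4 7) = [1, 35, 84, 70, 20] ∧ (List.range 5).map (enRank 5 8) = [1, 56, 140, 120, 35] ∧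
      1 + 20 + 4 = 10 + 15 ∧ 1 + 45 + 10 = 20 + 36 ∧ 1 + 84 + 20 = 35 + 70 ∧ 1 + 140 + 35 = 56 + 120 := by
  decide

/-- **Expected codimension of the corank-one stratum.** `Δ_{e-1} ⊂ Hom(ℂ^e, ℂ^f)` has codimension
`(f - (e-1))·(e - (e-1)) = f - e + 1 = p` (`1 ≤ e ≤ f`); `p` equations = the `p` entries of the residual column after splitting off
`I_{e-1}`, so `D_{e-1}(φ)` of codimension `p` is lci and E–N is locally a Koszul complex (memo §2, §7(e)).
[cite: Fulton1998, Thm. 14.4 (b)] -/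
theorem expectedCodim_corankOne (e f : ℕ) (he : 1 ≤ e) (hef : e ≤ f) :
    (f - (e - 1)) * (e - (e - 1)) = f - e + 1 := by
  have h1 : e - (e - 1) = 1 := by omega
  rw [h1, Nat.mul_one]
  omega

/-- **Third Newton identity** `3·e₃ = e₂·p₁ - e₁·p₂ + p₃` (four-variable instance; it holds for virtual alphabets in any
λ-ring). It is the identity behind the scalar consistency of K-B♮-det ∕ K-B♮-𝓜: `δc₄(V)(λ·id) = λ ∪ (rk V·c₃ + Σ_{m=1}^{3}
c_{3-m} Tr(At^m)) = (rk V - 3)·λ ∪ c₃(V)`, `= λ ∪ c₃(E)` for a rank-4 bundle (K-B♮ (C3)) and `= 0` for the rank-3 class `[𝓜]`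
— matching `ker e₂ ⊇ H^{0,2}·id_𝓜` (monad-4 RC-E♯ 2.2). [folklore] -/
theorem newton_girard_third {R : Type u} [CommRing R] (a b c d : R) :
    3 * (a * b * c + a * b * d + a * c * d + b * c * d) =
      (a * b + a * c + a * d + b * c + b * d + c * d) * (a + b + c + d) -
        (a + b + c + d) * (a ^ 2 + b ^ 2 + c ^ 2 + d ^ 2) + (a ^ 3 + b ^ 3 + c ^ 3 + d ^ 3) := by
  ring

/-- The same identity for a VIRTUAL alphabet `{k₁,k₂,k₃,k₄} ∕ {f₁}` (rank 3 = the class `[𝓜] = [K] - [F]` at `(e,f) = (1,4)`):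
with `E_i := c_i(K - F)` and `P_m := p_m(k) - p_m(f)` one still has `3·E₃ = E₂P₁ - E₁P₂ + P₃`, whence
`rk·E₃ - (E₂P₁ - E₁P₂ + P₃) = (3 - 3)·E₃ = 0`: the scalar direction of `𝓜` is killed by `δc₄([𝓜])`. [folklore] -/
theorem newton_girard_third_virtual {R : Type u} [CommRing R] (k₁ k₂ k₃ k₄ f : R) :
    let E₁ := k₁ + k₂ + k₃ + k₄ - f
    let E₂ := (k₁ * k₂ + k₁ * k₃ + k₁ * k₄ + k₂ * k₃ + k₂ * k₄ + k₃ * k₄) - f * (k₁ + k₂ + k₃ + k₄) + f ^ 2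
    let E₃ := (k₁ * k₂ * k₃ + k₁ * k₂ * k₄ + k₁ * k₃ * k₄ + k₂ * k₃ * k₄) -
      f * (k₁ * k₂ + k₁ * k₃ + k₁ * k₄ + k₂ * k₃ + k₂ * k₄ + k₃ * k₄) + f ^ 2 * (k₁ + k₂ + k₃ + k₄) - f ^ 3
    let P₁ := k₁ + k₂ + k₃ + k₄ - f
    let P₂ := k₁ ^ 2 + k₂ ^ 2 + k₃ ^ 2 + k₄ ^ 2 - f ^ 2
    let P₃ := k₁ ^ 3 + k₂ ^ 3 + k₃ ^ 3 + k₄ ^ 3 - f ^ 3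
    3 * E₃ = E₂ * P₁ - E₁ * P₂ + P₃ := by
  intro E₁ E₂ E₃ P₁ P₂ P₃
  simp only [E₁, E₂, E₃, P₁, P₂, P₃]
  ring

end NumbersDet

end HSemireg.C4KoszulBridge

end
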